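import Summits.CriticalPhenomena.PercolationContinuityZ3.Theorems.PercNearOneGluingNoHeavyLowerTailAntitheticBoxes
import HarnessLib

/-!
# `NoHeavyLowerTail` (stmt-CriticalPhenomena-4575) — antithetic cluster pairs: a STATIC CRITERION for red domination of a box
# (the "shielding" criterion, HOME/MEMO-gen62.md §1; prim-hp-2 gen 62)

Support file (`--supports stmt-CriticalPhenomena-4575`, hull-port prover `prim-hp-2`, gen 62).  No definitions, no named facts, no sorries;
standard axioms.  Notation of …AntitheticBoxes: edge set `E`, source `s`, a BOX `(Fix, N)` = the colourings `T ⊆ Sym2 V` with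
`e ∈ T ↔ e ∈ N` for `e ∈ Fix`; `X T = openCluster (T ∩ E) s`, `Y T = openCluster (Tᶜ ∩ E) s`.  Write `R = N ∩ Fix ∩ E` (pairs red in every
member), `RC = openCluster R s` (the red core), and for a vertex `u`, `K_u = openCluster R u` (its fixed-red component).

**`Antithetic.Box.dom_of_shielded`.**  Suppose that for every FIXED-BLUE pair `yu ∈ Fix ∩ E ∖ N` whose endpoint `u` is NOT in the red
core, the other endpoint `y` cannot be reached from `s` using pairs of `E` that are not fixed-red and do not meet `K_u` ("`u` is shielded").
Then the box is RED-DOMINATED: `Y T' ⊆ X T` for all members `T, T'` opposite off `Fix` — the hypothesis `hdom` of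
`Antithetic.Box.box_sum_nonneg` / `boxes_sum_nonneg`.  The criterion is purely graph-theoretic (no colourings), hence decidable for concrete
graphs and easy to verify for families (it is how the cells of THEOREM ⊕-CYCLE / PR4 were found: the single blue pair of a PTR cell is
entered from the free side and lands in the red core).  PROOF: walk induction along a blue path of `T'` from `s`: a free pair on it is red
in `T`; a fixed-blue pair `ab` either lands in `RC ⊆ X T`, or the walk so far has met `K_b` (then `b` is fixed-red-connected to a vertex
already in `X T`), or the walk so far avoids `K_b` and certifies that `a` is reachable — excluded by shielding.
[cite: VandenbergHaggstromKahn2005, §1 p. 3 (open cluster `C_s`)]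
-/

noncomputable section

namespace Summit.CriticalPhenomena.PercolationContinuityZ3.Theorems

open Literature.Probability.Percolation
open scoped Classical

namespace Antithetic

namespace Box

variable {V : Type*}

open Freeze in
/-- **Shielding criterion for red domination.**  If every fixed-blue pair `yu` (`yu ∈ Fix ∩ E`, `yu ∉ N`) with `u ∉ RC = openCluster (N ∩ Fix ∩ E) s`
has `y` unreachable from `s` through pairs of `E` that are not fixed-red and avoid `K_u = openCluster (N ∩ Fix ∩ E) u`, then for all members
`T, T'` of the box `(Fix, N)` that are opposite off `Fix`: `openCluster (T'ᶜ ∩ E) s ⊆ openCluster (T ∩ E) s`. [this work] -/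
theorem dom_of_shielded (E Fix N : Set (Sym2 V)) (s : V)
    (hsh : ∀ y u : V, s(y, u) ∈ E → s(y, u) ∈ Fix → s(y, u) ∉ N →
      u ∉ openCluster (N ∩ Fix ∩ E) s →
      y ∉ openCluster {e | e ∈ E ∧ ¬ (e ∈ Fix ∧ e ∈ N) ∧ ∀ v ∈ e, v ∉ openCluster (N ∩ Fix ∩ E) u} s)
    {T T' : Set (Sym2 V)} (hT : ∀ e ∈ Fix, (e ∈ T ↔ e ∈ N)) (hT' : ∀ e ∈ Fix, (e ∈ T' ↔ e ∈ N))
    (hflip : ∀ e ∉ Fix, (e ∈ T' ↔ e ∉ T)) :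
    openCluster (T'ᶜ ∩ E) s ⊆ openCluster (T ∩ E) s := by
  set R : Set (Sym2 V) := N ∩ Fix ∩ E with hR
  have hRT : R ⊆ T ∩ E := fun e he => ⟨(hT e he.1.2).2 he.1.1, he.2⟩
  -- walk induction: every vertex on a `T'`-blue walk from `s` lies in `X T`; and a walk avoiding a set `K` certifies reachability avoiding `K`
  have key : ∀ {u x : V} (p : (openGraph (T'ᶜ ∩ E)).Walk u x),
      (∀ y t : V, s(y, t) ∈ E → s(y, t) ∈ Fix → s(y, t) ∉ N → t ∉ openCluster R u →
        y ∉ openCluster {e | e ∈ E ∧ ¬ (e ∈ Fix ∧ e ∈ N) ∧ ∀ v ∈ e, v ∉ openCluster R t} u) →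
      ((∀ w ∈ p.support, w ∈ openCluster (T ∩ E) u) ∧
      (∀ K : Set V, (∀ w ∈ p.support, w ∉ K) →
        x ∈ openCluster {e | e ∈ E ∧ ¬ (e ∈ Fix ∧ e ∈ N) ∧ ∀ v ∈ e, v ∉ K} u)) := by
    intro u x p
    refine SimpleGraph.Walk.concatRec (motive := fun u x (p : (openGraph (T'ᶜ ∩ E)).Walk u x) =>
      (∀ y t : V, s(y, t) ∈ E → s(y, t) ∈ Fix → s(y, t) ∉ N → t ∉ openCluster R u →
        y ∉ openCluster {e | e ∈ E ∧ ¬ (e ∈ Fix ∧ e ∈ N) ∧ ∀ v ∈ e, v ∉ openCluster R t} u) →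
      ((∀ w ∈ p.support, w ∈ openCluster (T ∩ E) u) ∧
      (∀ K : Set V, (∀ w ∈ p.support, w ∉ K) →
        x ∈ openCluster {e | e ∈ E ∧ ¬ (e ∈ Fix ∧ e ∈ N) ∧ ∀ v ∈ e, v ∉ K} u))) ?_ ?_ p
    · intro u _
      refine ⟨fun w hw => ?_, fun K _ => mem_openCluster_self _ _⟩
      rw [SimpleGraph.Walk.support_nil, List.mem_singleton] at hw
      rw [hw]; exact mem_openCluster_self _ _
    · intro u a b q h ih hshu
      obtain ⟨ih1, ih2⟩ := ih hshu
      have h' := h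
      rw [openGraph_adj] at h'
      obtain ⟨⟨hbl, heE⟩, hne⟩ := h'
      have ha : a ∈ openCluster (T ∩ E) u := ih1 a q.end_mem_support
      have hb : b ∈ openCluster (T ∩ E) u := by
        by_cases hfix : s(a, b) ∈ Fix
        · have hN : s(a, b) ∉ N := fun hN => hbl ((hT' _ hfix).2 hN)
          by_cases hbRC : b ∈ openCluster R u
          · exact openCluster_mono hRT u hbRC
          · by_cases hmeet : ∃ w ∈ q.support, w ∈ openCluster R b
            · obtain ⟨w, hw, hwK⟩ := hmeet
              have hw' : w ∈ openCluster (T ∩ E) u := ih1 w hw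
              have hbw : w ∈ openCluster (T ∩ E) b := openCluster_mono hRT b hwK
              exact SimpleGraph.Reachable.trans hw' (SimpleGraph.Reachable.symm hbw)
            · push Not at hmeet
              exact absurd (ih2 _ hmeet) (hshu a b heE hfix hN hbRC)
        · have hred : s(a, b) ∈ T := by
            by_contra hc
            exact hbl ((hflip _ hfix).2 hc)
          exact mem_cluster_of_edge ha ⟨hred, heE⟩
      refine ⟨fun w hw => ?_, fun K hK => ?_⟩
      · rw [SimpleGraph.Walk.support_concat, List.mem_append, List.mem_singleton] at hw
        rcases hw with hw | hw
        · exact ih1 w hw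
        · rw [hw]; exact hb
      · have hK' : ∀ w ∈ q.support, w ∉ K := fun w hw =>
          hK w (by rw [SimpleGraph.Walk.support_concat]; exact List.mem_append_left _ hw)
        have haK : a ∉ K := hK' a q.end_mem_support
        have hbK : b ∉ K := hK b (by rw [SimpleGraph.Walk.support_concat]; simp)
        have hadj : (openGraph {e | e ∈ E ∧ ¬ (e ∈ Fix ∧ e ∈ N) ∧ ∀ v ∈ e, v ∉ K}).Adj a b := by
          rw [openGraph_adj]
          refine ⟨⟨heE, fun hfn => hbl ((hT' _ hfn.1).2 hfn.2), fun v hv => ?_⟩, hne⟩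
          rcases Sym2.mem_iff.1 hv with rfl | rfl
          · exact haK
          · exact hbK
        exact SimpleGraph.Reachable.trans (ih2 K hK') hadj.reachable
  intro x hx
  obtain ⟨p⟩ := hx
  exact (key p hsh).1 x p.end_mem_support

end Box

end Antithetic

end Summit.CriticalPhenomena.PercolationContinuityZ3.Theorems
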